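import Mathlib.Analysis.Calculus.ParametricIntegral
import Literature.Analysis.FluidPDE.NewtonKernel
import Literature.Analysis.FluidPDE.BiotSavartBounds
import HarnessLib

/-!
# Singular kernels of degree `−2` on `ℝ³`: smooth truncation and the regularised potentials

Topic `Literature/Analysis/FluidPDE`. First half of the `C¹`-regularity theory for potentials
`v(x) = ∫ K(x − y) f(y) dy` with a kernel `K : ℝ³ → (V →L[ℝ] W)` which is `C¹` away from the
origin and satisfies `‖K(z)‖ ≤ A |z|⁻²`, `‖∇K(z)‖ ≤ A |z|⁻³` — the Biot–Savart kernel
`K₃(x) h = (4π)⁻¹ h × x/|x|³` of Majda–Bertozzi, *Vorticity and Incompressible Flow* (CUP 2002),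
(2.94)–(2.95) and (4.30)–(4.31) ("`K_N` homogeneous of degree `1 − N`", "`P_N = ∇K_N` homogeneous
of degree `−N`"), and first derivatives of the Newtonian kernel. Following Gilbarg–Trudinger,
*Elliptic PDE of Second Order*, §4.1, proof of Lemma 4.1/4.2 (the regularisation
`w_ε = ∫ Γ η_ε f`), the singularity is cut out smoothly:
`K_ε = (1 − θ_ε) K`, `θ_ε = radialCutoff ε (2ε)` (the tree's radial cutoff, `NewtonKernel.lean`),
so that `K_ε` is `C¹` on all of `ℝ³`, vanishes on `|z| ≤ ε`, agrees with `K` on `|z| ≥ 2ε`, and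
obeys the same bounds with a constant independent of `ε`.

Relation to `NewtonPotentialHolder.IsSingularKernel` (`NewtonPotentialHolder.lean`, scalar kernels of
degree `−a` with the size bound and a Hörmander-type regularity bound, measurable, for
potentials of `L^p` densities): the class here is operator-valued, `C¹` off the origin and of
degree `−2` with a bound on the *derivative*; by the mean value inequality on the segment
`[x − y, z − y]` (as in `NewtonPotentialHolder.isSingularKernel_newtonKernelGrad`) a kernel in the
present sense satisfies the Hörmander bound of that file with `a = 2`; the two files address
different density classes (`C^γ` here, `L^p` there) and are independent.

## Contents (all proved)

* `IsC1SingularKernel K A` — the kernel class (three inequalities and `C¹` off `0`; named apart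
  from `NewtonPotentialHolder.IsSingularKernel`, see above);
* `radialCutoff` at scale `ε`: the derivative bound `‖∇θ_ε(z)‖ ≤ B/ε` with a universal `B`
  (`exists_norm_fderiv_radialCutoff_le`, by scaling from `ε = 1`);
* `truncKernel K ε = (1 − θ_ε) • K`: `contDiff_truncKernel`, `truncKernel_eq_zero` (`|z| ≤ ε`),
  `truncKernel_eq` (`2ε ≤ |z|`), `norm_truncKernel_le` (`≤ A|z|⁻²`, `≤ A ε⁻²`),
  `norm_fderiv_truncKernel_le` (`≤ A(1 + 2B)|z|⁻³`, `≤ A(1+2B) ε⁻³`);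
* the regularised potential `truncPotential K ε f x = ∫ K_ε(x − y) f(y) dy` of a continuous
  compactly supported density is differentiable with
  `∇(truncPotential) x = ∫ (∇K_ε(x − y) ·)(f y) dy` (`hasFDerivAt_truncPotential`, dominated
  differentiation under the integral);
* the potential `singularPotential K f x = ∫ K(x − y) f(y) dy` itself: its integrand is a.e.
  strongly measurable and integrable (`aestronglyMeasurable_kernel_sub_apply`,
  `norm_kernel_sub_apply_le`, `integrable_kernel_sub_apply`), and
  `norm_truncPotential_sub_singularPotential_le` — `‖v_ε(x) − v(x)‖ ≤ 12π A M ε` for `|f| ≤ M`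
  (the regularised potentials converge uniformly; `kernelMajorant` of `BiotSavartBounds.lean`);
* `holderMajorant γ ρ = 1_{|z|<ρ} |z|^{γ−3}`, `integrable_holderMajorant` (`γ > 0`) and
  `integral_holderMajorant` — `∫_{|z|<ρ} |z|^{γ−3} dz = 4π ρ^γ/γ`, the radial integral controlling
  the Hölder-vanishing part in the second half (`SingularKernelGradient.lean`).

## References

* D. Gilbarg, N. S. Trudinger, *Elliptic Partial Differential Equations of Second Order*
  (Springer 2001), §4.1, Lemmas 4.1–4.2 (regularised Newtonian potentials). [GilbargTrudinger2001]
* A. J. Majda, A. L. Bertozzi, *Vorticity and Incompressible Flow* (CUP 2002), §2.4.2–2.4.3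
  (Props 2.17–2.20: distribution derivatives of kernels homogeneous of degree `1 − N`), §4.1.3
  (4.29)–(4.33). [MajdaBertozziCUP2002]
-/

noncomputable section

open MeasureTheory Set Function Filter Metric Real
open _root_.Topology
open scoped ENNReal NNReal

namespace Literature.Analysis.FluidPDE

/-- Local notation for physical space `ℝ³ = EuclideanSpace ℝ (Fin 3)`. -/
local notation "ℝ³" => EuclideanSpace ℝ (Fin 3)

variable {V W : Type*} [NormedAddCommGroup V] [NormedSpace ℝ V] [NormedAddCommGroup W]
  [NormedSpace ℝ W]

/-! ### The kernel class -/

/-- **Singular kernels of degree `−2` on `ℝ³`**: `K` is `C¹` away from the origin,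
`‖K(z)‖ ≤ A (‖z‖²)⁻¹` for all `z` (so `K 0 = 0`, the junk value of `biotSavartKernel`), and
`‖∇K(z)‖ ≤ A (‖z‖³)⁻¹` for `z ≠ 0` (Majda–Bertozzi (4.30)–(4.31): `K_N` homogeneous of degree
`1 − N` and smooth off `0`, `P_N = ∇K_N` homogeneous of degree `−N`; Gilbarg–Trudinger (2.14) for
`DΓ`, `D²Γ`). [folklore] -/
structure IsC1SingularKernel (K : ℝ³ → V →L[ℝ] W) (A : ℝ) : Prop where
  /-- `K` is `C¹` near every `z ≠ 0`. -/
  contDiffAt : ∀ z : ℝ³, z ≠ 0 → ContDiffAt ℝ 1 K z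
  /-- Size: `‖K z‖ ≤ A |z|⁻²`. -/
  norm_le : ∀ z : ℝ³, ‖K z‖ ≤ A * (‖z‖ ^ 2)⁻¹
  /-- Size of the derivative: `‖∇K z‖ ≤ A |z|⁻³` off the origin. -/
  norm_fderiv_le : ∀ z : ℝ³, z ≠ 0 → ‖fderiv ℝ K z‖ ≤ A * (‖z‖ ^ 3)⁻¹

namespace IsC1SingularKernel

variable {K : ℝ³ → V →L[ℝ] W} {A : ℝ}

/-- The constant of a singular kernel is nonnegative (unless `V` is trivial the bound at any
`z ≠ 0` forces it; in general we read it off `‖K z‖ ≥ 0`). [folklore] -/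
theorem nonneg (hK : IsC1SingularKernel K A) : 0 ≤ A := by
  have h := hK.norm_le (EuclideanSpace.single 0 1)
  have hn : ‖(EuclideanSpace.single (0 : Fin 3) (1 : ℝ))‖ = 1 := by simp
  rw [hn, one_pow, inv_one, mul_one] at h
  exact (norm_nonneg _).trans h

/-- A singular kernel vanishes at the origin (junk value forced by the size bound). [folklore] -/
theorem apply_zero (hK : IsC1SingularKernel K A) : K 0 = 0 := by
  have h := hK.norm_le 0
  rw [norm_zero, zero_pow two_ne_zero, inv_zero, mul_zero] at h
  exact norm_le_zero_iff.1 h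

/-- A singular kernel is continuous away from the origin. [folklore] -/
theorem continuousOn (hK : IsC1SingularKernel K A) : ContinuousOn K {0}ᶜ := fun z hz =>
  (hK.contDiffAt z hz).continuousAt.continuousWithinAt

/-- A singular kernel is differentiable away from the origin. [folklore] -/
theorem differentiableAt (hK : IsC1SingularKernel K A) {z : ℝ³} (hz : z ≠ 0) :
    DifferentiableAt ℝ K z :=
  (hK.contDiffAt z hz).differentiableAt one_ne_zero

end IsC1SingularKernel

/-! ### The scaled radial cutoff and its derivative -/

/-- The cutoff at scale `ε`: `θ_ε = radialCutoff ε (2ε)`, equal to `1` on `|z| ≤ ε` and to `0` on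
`|z| ≥ 2ε`; it is the unit cutoff rescaled, `θ_ε(z) = θ₁(ε⁻¹ z)`. [folklore] -/
theorem radialCutoff_eps_eq_scale {ε : ℝ} (hε : 0 < ε) (z : ℝ³) :
    radialCutoff ε (2 * ε) z = radialCutoff 1 2 (ε⁻¹ • z) := by
  have h := radialCutoff_scale (E := ℝ³) (r₀ := 1) (r₁ := 2) hε z
  rw [mul_one] at h
  rw [← h]
  ring_nf

/-- **Uniform derivative bound for the scaled cutoff**: there is `B ≥ 0` with
`‖∇θ_ε(z)‖ ≤ B ε⁻¹` for all `ε > 0` and all `z` (chain rule from the unit scale, where `∇θ₁` is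
continuous with compact support). [folklore] -/
theorem exists_norm_fderiv_radialCutoff_le :
    ∃ B : ℝ, 0 ≤ B ∧ ∀ ε : ℝ, 0 < ε → ∀ z : ℝ³, ‖fderiv ℝ (radialCutoff ε (2 * ε)) z‖ ≤ B * ε⁻¹ := by
  -- bound at the unit scale
  have hsm : ContDiff ℝ 1 (radialCutoff 1 2 : ℝ³ → ℝ) := radialCutoff_contDiff 1 2
  have hc : Continuous (fderiv ℝ (radialCutoff 1 2 : ℝ³ → ℝ)) := hsm.continuous_fderiv one_ne_zero
  have hsupp : HasCompactSupport (fderiv ℝ (radialCutoff 1 2 : ℝ³ → ℝ)) :=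
    (hasCompactSupport_radialCutoff (E := ℝ³) zero_le_one one_lt_two).fderiv (𝕜 := ℝ)
  obtain ⟨B, hB⟩ := hc.bounded_above_of_compact_support hsupp
  refine ⟨max B 0, le_max_right _ _, fun ε hε z => ?_⟩
  have hfun : (radialCutoff ε (2 * ε) : ℝ³ → ℝ) = fun z => radialCutoff 1 2 (ε⁻¹ • z) :=
    funext (radialCutoff_eps_eq_scale hε)
  rw [hfun]
  have hd : DifferentiableAt ℝ (radialCutoff 1 2 : ℝ³ → ℝ) (ε⁻¹ • z) :=
    (hsm.differentiable one_ne_zero) _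
  have hchain : fderiv ℝ (fun z : ℝ³ => radialCutoff 1 2 (ε⁻¹ • z)) z =
      ε⁻¹ • fderiv ℝ (radialCutoff 1 2 : ℝ³ → ℝ) (ε⁻¹ • z) := by
    have h1 : HasFDerivAt (fun z : ℝ³ => ε⁻¹ • z) (ε⁻¹ • ContinuousLinearMap.id ℝ ℝ³) z :=
      (hasFDerivAt_id z).const_smul ε⁻¹
    have h2 : HasFDerivAt (fun z : ℝ³ => radialCutoff 1 2 (ε⁻¹ • z))
        ((fderiv ℝ (radialCutoff 1 2 : ℝ³ → ℝ) (ε⁻¹ • z)).comp (ε⁻¹ • ContinuousLinearMap.id ℝ ℝ³)) z :=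
      hd.hasFDerivAt.comp z h1
    rw [h2.fderiv]
    ext w
    simp
  rw [hchain, norm_smul, norm_inv, Real.norm_eq_abs, abs_of_pos hε, mul_comm]
  gcongr
  exact (hB _).trans (le_max_left _ _)

/-! ### The truncated kernel -/

/-- **The smoothly truncated kernel** `K_ε(z) = (1 − θ_ε(z)) K(z)`: the singularity at the origin
is cut out (Gilbarg–Trudinger §4.1, `η_ε`). [folklore] -/
def truncKernel (K : ℝ³ → V →L[ℝ] W) (ε : ℝ) (z : ℝ³) : V →L[ℝ] W :=
  (1 - radialCutoff ε (2 * ε) z) • K z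

/-- `K_ε = 0` on the closed ball of radius `ε`. [folklore] -/
theorem truncKernel_eq_zero (K : ℝ³ → V →L[ℝ] W) {ε : ℝ} (hε : 0 < ε) {z : ℝ³} (hz : ‖z‖ ≤ ε) :
    truncKernel K ε z = 0 := by
  rw [truncKernel, radialCutoff_eq_one hε.le (by linarith) hz, sub_self, zero_smul]

/-- `K_ε = K` off the open ball of radius `2ε`. [folklore] -/
theorem truncKernel_eq (K : ℝ³ → V →L[ℝ] W) {ε : ℝ} (hε : 0 < ε) {z : ℝ³} (hz : 2 * ε ≤ ‖z‖) :
    truncKernel K ε z = K z := by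
  rw [truncKernel, radialCutoff_eq_zero hε.le (by linarith) hz, sub_zero, one_smul]

/-- `K_ε` vanishes near every point of the open ball of radius `ε`. [folklore] -/
theorem truncKernel_eventuallyEq_zero (K : ℝ³ → V →L[ℝ] W) {ε : ℝ} (hε : 0 < ε) {z : ℝ³}
    (hz : ‖z‖ < ε) : truncKernel K ε =ᶠ[𝓝 z] fun _ => 0 := by
  filter_upwards [isOpen_ball.mem_nhds (mem_ball_zero_iff.2 hz)] with w hw
  exact truncKernel_eq_zero K hε (mem_ball_zero_iff.1 hw).le

/-- **Size of the truncated kernel**: `‖K_ε z‖ ≤ ‖K z‖ ≤ A |z|⁻²`. [folklore] -/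
theorem norm_truncKernel_le {K : ℝ³ → V →L[ℝ] W} {A : ℝ} (hK : IsC1SingularKernel K A) (ε : ℝ)
    (z : ℝ³) : ‖truncKernel K ε z‖ ≤ A * (‖z‖ ^ 2)⁻¹ := by
  rw [truncKernel, norm_smul, Real.norm_eq_abs]
  have h1 : |1 - radialCutoff ε (2 * ε) z| ≤ 1 := by
    rw [abs_le]
    constructor <;> linarith [radialCutoff_nonneg ε (2 * ε) z, radialCutoff_le_one ε (2 * ε) z]
  calc |1 - radialCutoff ε (2 * ε) z| * ‖K z‖ ≤ 1 * ‖K z‖ := by gcongr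
    _ = ‖K z‖ := one_mul _
    _ ≤ A * (‖z‖ ^ 2)⁻¹ := hK.norm_le z

/-- **The truncated kernel is bounded**: `‖K_ε z‖ ≤ A ε⁻²`. [folklore] -/
theorem norm_truncKernel_le_const {K : ℝ³ → V →L[ℝ] W} {A : ℝ} (hK : IsC1SingularKernel K A) {ε : ℝ}
    (hε : 0 < ε) (z : ℝ³) : ‖truncKernel K ε z‖ ≤ A * (ε ^ 2)⁻¹ := by
  rcases le_or_gt ‖z‖ ε with hz | hz
  · rw [truncKernel_eq_zero K hε hz, norm_zero]
    exact mul_nonneg hK.nonneg (by positivity)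
  · refine (norm_truncKernel_le hK ε z).trans ?_
    gcongr
    · exact hK.nonneg

/-- **The truncated kernel is `C¹` on all of `ℝ³`**: near the origin it vanishes identically, and
off the origin it is the product of the smooth factor `1 − θ_ε` with the `C¹` kernel. [folklore] -/
theorem contDiff_truncKernel {K : ℝ³ → V →L[ℝ] W} {A : ℝ} (hK : IsC1SingularKernel K A) {ε : ℝ}
    (hε : 0 < ε) : ContDiff ℝ 1 (truncKernel K ε) := by
  rw [contDiff_iff_contDiffAt]
  intro z
  by_cases hz : ‖z‖ < ε
  · exact (contDiffAt_const (c := (0 : V →L[ℝ] W))).congr_of_eventuallyEq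
      (truncKernel_eventuallyEq_zero K hε hz)
  · have hz0 : z ≠ 0 := by
      intro h
      rw [h, norm_zero] at hz
      exact hz hε
    have hθc : ContDiff ℝ 1 (radialCutoff ε (2 * ε) : ℝ³ → ℝ) := radialCutoff_contDiff ε (2 * ε)
    exact (contDiff_const.sub hθc).contDiffAt.smul (hK.contDiffAt z hz0)

/-- The derivative of the truncated kernel off the origin (product rule):
`∇K_ε(z) e = −(∇θ_ε(z) e) K(z) + (1 − θ_ε(z)) ∇K(z) e`. [folklore] -/
theorem fderiv_truncKernel_apply {K : ℝ³ → V →L[ℝ] W} {A : ℝ} (hK : IsC1SingularKernel K A) {ε : ℝ}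
    {z : ℝ³} (hz : z ≠ 0) (e : ℝ³) :
    fderiv ℝ (truncKernel K ε) z e =
      -(fderiv ℝ (radialCutoff ε (2 * ε)) z e) • K z +
        (1 - radialCutoff ε (2 * ε) z) • fderiv ℝ K z e := by
  have hθ : DifferentiableAt ℝ (fun w : ℝ³ => 1 - radialCutoff ε (2 * ε) w) z :=
    ((radialCutoff_contDiff (E' := ℝ³) ε (2 * ε) (n := 1)).differentiable one_ne_zero z).const_sub 1
  change fderiv ℝ (fun w => (1 - radialCutoff ε (2 * ε) w) • K w) z e = _
  rw [fderiv_fun_smul hθ (hK.differentiableAt hz), fderiv_const_sub]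
  simp only [add_apply, smul_apply,
    ContinuousLinearMap.smulRight_apply, neg_apply, neg_smul]
  abel

/-- **Size of the derivative of the truncated kernel**: with the cutoff constant `B` of
`exists_norm_fderiv_radialCutoff_le`, `‖∇K_ε(z)‖ ≤ A (1 + 2B) |z|⁻³` for `z ≠ 0` (on the shell
`ε ≤ |z| ≤ 2ε` where `∇θ_ε ≠ 0` one has `ε⁻¹ ≤ 2|z|⁻¹`). [folklore] -/
theorem norm_fderiv_truncKernel_le {K : ℝ³ → V →L[ℝ] W} {A : ℝ} (hK : IsC1SingularKernel K A)
    {B : ℝ} (hB0 : 0 ≤ B)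
    (hB : ∀ ε : ℝ, 0 < ε → ∀ z : ℝ³, ‖fderiv ℝ (radialCutoff ε (2 * ε)) z‖ ≤ B * ε⁻¹)
    {ε : ℝ} (hε : 0 < ε) {z : ℝ³} (hz : z ≠ 0) :
    ‖fderiv ℝ (truncKernel K ε) z‖ ≤ A * (1 + 2 * B) * (‖z‖ ^ 3)⁻¹ := by
  have hA := hK.nonneg
  have hzn : 0 < ‖z‖ := norm_pos_iff.2 hz
  by_cases hsmall : ‖z‖ < ε
  · -- `K_ε` vanishes near `z`
    have : fderiv ℝ (truncKernel K ε) z = 0 := by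
      rw [(truncKernel_eventuallyEq_zero K hε hsmall).fderiv_eq]
      exact fderiv_const_apply 0
    have hn : ‖fderiv ℝ (truncKernel K ε) z‖ = 0 := by
      rw [this]
      exact norm_zero (E := ℝ³ →L[ℝ] V →L[ℝ] W)
    rw [hn]
    positivity
  · have hεz : ε ≤ ‖z‖ := not_lt.1 hsmall
    refine ContinuousLinearMap.opNorm_le_bound _ (by positivity) fun e => ?_
    rw [fderiv_truncKernel_apply hK hz e]
    -- the cutoff-derivative term
    have hcut : ‖-(fderiv ℝ (radialCutoff ε (2 * ε)) z e) • K z‖ ≤ 2 * A * B * (‖z‖ ^ 3)⁻¹ * ‖e‖ := by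
      by_cases hbig : 2 * ε < ‖z‖
      · -- `θ_ε` is locally zero, so its derivative vanishes
        have h0 : fderiv ℝ (radialCutoff ε (2 * ε)) z = 0 := by
          rw [(radialCutoff_eventuallyEq_zero (E := ℝ³) hε.le (by linarith) hbig).fderiv_eq]
          exact fderiv_const_apply (0 : ℝ)
        rw [h0, zero_apply, neg_zero, zero_smul, norm_zero]
        positivity
      · have hz2 : ‖z‖ ≤ 2 * ε := not_lt.1 hbig
        rw [norm_smul, norm_neg, Real.norm_eq_abs]
        have h1 : |fderiv ℝ (radialCutoff ε (2 * ε)) z e| ≤ B * ε⁻¹ * ‖e‖ := by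
          rw [← Real.norm_eq_abs]
          exact (ContinuousLinearMap.le_opNorm _ e).trans (by gcongr; exact hB ε hε z)
        have h2 : ‖K z‖ ≤ A * (‖z‖ ^ 2)⁻¹ := hK.norm_le z
        have hεinv : ε⁻¹ ≤ 2 * ‖z‖⁻¹ := by
          rw [← div_eq_mul_inv, le_div_iff₀ hzn, inv_mul_le_iff₀ hε]
          linarith
        calc |fderiv ℝ (radialCutoff ε (2 * ε)) z e| * ‖K z‖
            ≤ (B * ε⁻¹ * ‖e‖) * (A * (‖z‖ ^ 2)⁻¹) := by gcongr
          _ ≤ (B * (2 * ‖z‖⁻¹) * ‖e‖) * (A * (‖z‖ ^ 2)⁻¹) := by gcongr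
          _ = 2 * A * B * (‖z‖ ^ 3)⁻¹ * ‖e‖ := by
              field_simp
    -- the kernel-derivative term
    have hker : ‖(1 - radialCutoff ε (2 * ε) z) • fderiv ℝ K z e‖ ≤ A * (‖z‖ ^ 3)⁻¹ * ‖e‖ := by
      rw [norm_smul, Real.norm_eq_abs]
      have h1 : |1 - radialCutoff ε (2 * ε) z| ≤ 1 := by
        rw [abs_le]
        constructor <;>
          linarith [radialCutoff_nonneg ε (2 * ε) z, radialCutoff_le_one ε (2 * ε) z]
      have h2 : ‖fderiv ℝ K z e‖ ≤ A * (‖z‖ ^ 3)⁻¹ * ‖e‖ :=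
        (ContinuousLinearMap.le_opNorm _ e).trans (by gcongr; exact hK.norm_fderiv_le z hz)
      calc |1 - radialCutoff ε (2 * ε) z| * ‖fderiv ℝ K z e‖ ≤ 1 * (A * (‖z‖ ^ 3)⁻¹ * ‖e‖) := by
            gcongr
        _ = A * (‖z‖ ^ 3)⁻¹ * ‖e‖ := one_mul _
    calc ‖-(fderiv ℝ (radialCutoff ε (2 * ε)) z e) • K z + (1 - radialCutoff ε (2 * ε) z) • fderiv ℝ K z e‖
        ≤ ‖-(fderiv ℝ (radialCutoff ε (2 * ε)) z e) • K z‖ +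
            ‖(1 - radialCutoff ε (2 * ε) z) • fderiv ℝ K z e‖ := norm_add_le _ _
      _ ≤ 2 * A * B * (‖z‖ ^ 3)⁻¹ * ‖e‖ + A * (‖z‖ ^ 3)⁻¹ * ‖e‖ := add_le_add hcut hker
      _ = A * (1 + 2 * B) * (‖z‖ ^ 3)⁻¹ * ‖e‖ := by ring

/-- **The derivative of the truncated kernel is bounded**: `‖∇K_ε(z)‖ ≤ A(1 + 2B) ε⁻³` for all
`z` (it vanishes on `|z| < ε`). [folklore] -/
theorem norm_fderiv_truncKernel_le_const {K : ℝ³ → V →L[ℝ] W} {A : ℝ} (hK : IsC1SingularKernel K A)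
    {B : ℝ} (hB0 : 0 ≤ B)
    (hB : ∀ ε : ℝ, 0 < ε → ∀ z : ℝ³, ‖fderiv ℝ (radialCutoff ε (2 * ε)) z‖ ≤ B * ε⁻¹)
    {ε : ℝ} (hε : 0 < ε) (z : ℝ³) :
    ‖fderiv ℝ (truncKernel K ε) z‖ ≤ A * (1 + 2 * B) * (ε ^ 3)⁻¹ := by
  have hA := hK.nonneg
  by_cases hsmall : ‖z‖ < ε
  · have : fderiv ℝ (truncKernel K ε) z = 0 := by
      rw [(truncKernel_eventuallyEq_zero K hε hsmall).fderiv_eq]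
      exact fderiv_const_apply 0
    have hn : ‖fderiv ℝ (truncKernel K ε) z‖ = 0 := by
      rw [this]
      exact norm_zero (E := ℝ³ →L[ℝ] V →L[ℝ] W)
    rw [hn]
    positivity
  · have hεz : ε ≤ ‖z‖ := not_lt.1 hsmall
    have hz : z ≠ 0 := by
      intro h
      rw [h, norm_zero] at hεz
      exact absurd hεz (not_le.2 hε)
    refine (norm_fderiv_truncKernel_le hK hB0 hB hε hz).trans ?_
    gcongr

/-- **The truncated kernel is again a singular kernel** with the `ε`-independent constant
`A (1 + 2B)`. [folklore] -/
theorem isC1SingularKernel_truncKernel {K : ℝ³ → V →L[ℝ] W} {A : ℝ} (hK : IsC1SingularKernel K A)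
    {B : ℝ} (hB0 : 0 ≤ B)
    (hB : ∀ ε : ℝ, 0 < ε → ∀ z : ℝ³, ‖fderiv ℝ (radialCutoff ε (2 * ε)) z‖ ≤ B * ε⁻¹)
    {ε : ℝ} (hε : 0 < ε) : IsC1SingularKernel (truncKernel K ε) (A * (1 + 2 * B)) where
  contDiffAt z _ := (contDiff_truncKernel hK hε).contDiffAt
  norm_le z := (norm_truncKernel_le hK ε z).trans (by
    have := hK.nonneg
    have h1 : A ≤ A * (1 + 2 * B) := le_mul_of_one_le_right this (by linarith)
    gcongr)
  norm_fderiv_le z hz := norm_fderiv_truncKernel_le hK hB0 hB hε hz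

/-! ### The regularised potential and its derivative -/

section Potential

/-- **The regularised potential** `v_ε(x) = ∫ K_ε(x − y) f(y) dy` (Gilbarg–Trudinger §4.1,
`w_ε`). [folklore] -/
def truncPotential (K : ℝ³ → V →L[ℝ] W) (ε : ℝ) (f : ℝ³ → V) (x : ℝ³) : W :=
  ∫ y, truncKernel K ε (x - y) (f y)

/-- The integrand of the regularised potential is continuous in `y`. [folklore] -/
theorem continuous_truncKernel_sub_apply {K : ℝ³ → V →L[ℝ] W} {A : ℝ} (hK : IsC1SingularKernel K A)
    {ε : ℝ} (hε : 0 < ε) {f : ℝ³ → V} (hf : Continuous f) (x : ℝ³) :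
    Continuous fun y => truncKernel K ε (x - y) (f y) :=
  (((contDiff_truncKernel hK hε).continuous.comp (continuous_const.sub continuous_id))).clm_apply hf

/-- The integrand of the regularised potential is supported in the support of the density. [folklore] -/
theorem hasCompactSupport_truncKernel_sub_apply (K : ℝ³ → V →L[ℝ] W) (ε : ℝ) {f : ℝ³ → V}
    (hfc : HasCompactSupport f) (x : ℝ³) :
    HasCompactSupport fun y => truncKernel K ε (x - y) (f y) :=
  hfc.mono fun y hy => by
    contrapose! hy
    rw [notMem_support] at hy ⊢
    simp [hy]

/-- **The regularised potential is differentiable, with derivative under the integral sign**: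
`∇v_ε(x) = ∫ (∇K_ε(x − y) ·)(f y) dy`, i.e. `∇v_ε(x) e = ∫ (∇K_ε(x−y) e)(f y) dy`, for a continuous
compactly supported density `f` (dominated differentiation: `∇K_ε` is bounded by
`A(1+2B) ε⁻³`, Mathlib `hasFDerivAt_integral_of_dominated_of_fderiv_le`; Gilbarg–Trudinger §4.1,
proof of Lemma 4.1). [folklore] -/
theorem hasFDerivAt_truncPotential {K : ℝ³ → V →L[ℝ] W} {A : ℝ} (hK : IsC1SingularKernel K A)
    {ε : ℝ} (hε : 0 < ε) {f : ℝ³ → V} (hf : Continuous f) (hfc : HasCompactSupport f) (x₀ : ℝ³) :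
    HasFDerivAt (truncPotential K ε f)
      (∫ y, (fderiv ℝ (truncKernel K ε) (x₀ - y)).flip (f y)) x₀ := by
  obtain ⟨B, hB0, hB⟩ := exists_norm_fderiv_radialCutoff_le
  set C : ℝ := A * (1 + 2 * B) * (ε ^ 3)⁻¹ with hC
  have hcont : ContDiff ℝ 1 (truncKernel K ε) := contDiff_truncKernel hK hε
  have hDc : Continuous (fderiv ℝ (truncKernel K ε)) := hcont.continuous_fderiv one_ne_zero
  -- the derivative integrand and its continuity in `y`
  have hF'c : ∀ x : ℝ³, Continuous fun y => (fderiv ℝ (truncKernel K ε) (x - y)).flip (f y) := by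
    intro x
    have h1 : Continuous fun y => (fderiv ℝ (truncKernel K ε) (x - y)).flip :=
      (ContinuousLinearMap.flipₗᵢ ℝ ℝ³ V W).continuous.comp
        (hDc.comp (continuous_const.sub continuous_id))
    exact h1.clm_apply hf
  unfold truncPotential
  refine hasFDerivAt_integral_of_dominated_of_fderiv_le (𝕜 := ℝ) (μ := volume) (s := univ)
    (F := fun x y => truncKernel K ε (x - y) (f y))
    (F' := fun x y => (fderiv ℝ (truncKernel K ε) (x - y)).flip (f y))
    (bound := fun y => C * ‖f y‖) univ_mem ?_ ?_ ?_ ?_ ?_ ?_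
  · exact Eventually.of_forall fun x =>
      (continuous_truncKernel_sub_apply hK hε hf x).aestronglyMeasurable
  · exact (continuous_truncKernel_sub_apply hK hε hf x₀).integrable_of_hasCompactSupport
      (hasCompactSupport_truncKernel_sub_apply K ε hfc x₀)
  · exact (hF'c x₀).aestronglyMeasurable
  · refine Eventually.of_forall fun y x _ => ?_
    calc ‖(fderiv ℝ (truncKernel K ε) (x - y)).flip (f y)‖
        ≤ ‖(fderiv ℝ (truncKernel K ε) (x - y)).flip‖ * ‖f y‖ := ContinuousLinearMap.le_opNorm _ _
      _ = ‖fderiv ℝ (truncKernel K ε) (x - y)‖ * ‖f y‖ := by rw [ContinuousLinearMap.opNorm_flip]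
      _ ≤ C * ‖f y‖ := by
          gcongr
          exact norm_fderiv_truncKernel_le_const hK hB0 hB hε (x - y)
  · have hb : HasCompactSupport (fun y => C * ‖f y‖) := hfc.norm.mul_left
    exact ((hf.norm).const_mul C).integrable_of_hasCompactSupport hb
  · refine Eventually.of_forall fun y x _ => ?_
    have h1 : HasFDerivAt (truncKernel K ε) (fderiv ℝ (truncKernel K ε) (x - y)) (x - y) :=
      ((hcont.differentiable one_ne_zero) _).hasFDerivAt
    have h2 : HasFDerivAt (fun x : ℝ³ => x - y) (ContinuousLinearMap.id ℝ ℝ³) x :=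
      (hasFDerivAt_id x).sub_const y
    have h3 := h1.comp x h2
    have h4 := h3.clm_apply (hasFDerivAt_const (f y) x)
    refine h4.congr_fderiv ?_
    ext e
    simp

end Potential

/-! ### The singular potential: the integrand, and uniform approximation by `v_ε` -/

section Singular

/-- **The potential** `v(x) = ∫ K(x − y) f(y) dy` of a density `f` (Bochner integral; for
`K = K₃` this is `biotSavart f`). [folklore] -/
def singularPotential (K : ℝ³ → V →L[ℝ] W) (f : ℝ³ → V) (x : ℝ³) : W :=
  ∫ y, K (x - y) (f y)

/-- The singular integrand `y ↦ K(x − y) f(y)` is a.e. strongly measurable for continuous `f`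
(it is continuous off the null set `{x}`). [folklore] -/
theorem aestronglyMeasurable_kernel_sub_apply {K : ℝ³ → V →L[ℝ] W} {A : ℝ} (hK : IsC1SingularKernel K A)
    {f : ℝ³ → V} (hf : Continuous f) (x : ℝ³) :
    AEStronglyMeasurable (fun y => K (x - y) (f y)) volume := by
  have hcont : ContinuousOn (fun y => K (x - y) (f y)) {x}ᶜ := by
    refine ContinuousOn.clm_apply ?_ hf.continuousOn
    refine hK.continuousOn.comp (continuous_const.sub continuous_id).continuousOn fun y hy => ?_
    simp only [mem_compl_iff, mem_singleton_iff] at hy ⊢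
    exact sub_ne_zero.2 (Ne.symm hy)
  have h := hcont.aestronglyMeasurable (μ := volume) (measurableSet_singleton x).compl
  rwa [restrict_compl_singleton] at h

/-- **Domination of the singular integrand**: if `|f| ≤ M` and `supp f ⊆ B̄(x₀, R)`, then for
every `x`, `‖K(x − y) f(y)‖ ≤ A M 1_{|x−y| < |x−x₀|+R+1} |x − y|⁻²` (the truncated majorant
`kernelMajorant` of `BiotSavartBounds.lean`, translated to `x`). [folklore] -/
theorem norm_kernel_sub_apply_le {K : ℝ³ → V →L[ℝ] W} {A : ℝ} (hK : IsC1SingularKernel K A)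
    {f : ℝ³ → V} {x₀ : ℝ³} {R M : ℝ} (hM : ∀ y, ‖f y‖ ≤ M) (hsupp : support f ⊆ closedBall x₀ R)
    (x y : ℝ³) :
    ‖K (x - y) (f y)‖ ≤ A * M * kernelMajorant (‖x - x₀‖ + R + 1) (x - y) := by
  have hA := hK.nonneg
  have hM0 : 0 ≤ M := (norm_nonneg _).trans (hM y)
  by_cases hy : y ∈ support f
  · have hyb : ‖x - y‖ < ‖x - x₀‖ + R + 1 := by
      have h1 := hsupp hy
      rw [mem_closedBall, dist_eq_norm] at h1
      have h2 : ‖x - y‖ ≤ ‖x - x₀‖ + ‖x₀ - y‖ := norm_sub_le_norm_sub_add_norm_sub x x₀ y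
      rw [norm_sub_rev x₀ y] at h2
      linarith
    have hmaj : kernelMajorant (‖x - x₀‖ + R + 1) (x - y) = (‖x - y‖ ^ 2)⁻¹ := by
      simp [kernelMajorant, indicator, hyb]
    rw [hmaj]
    calc ‖K (x - y) (f y)‖ ≤ ‖K (x - y)‖ * ‖f y‖ := ContinuousLinearMap.le_opNorm _ _
      _ ≤ A * (‖x - y‖ ^ 2)⁻¹ * M := by gcongr <;> first | exact hK.norm_le _ | exact hM y
      _ = A * M * (‖x - y‖ ^ 2)⁻¹ := by ring
  · rw [notMem_support] at hy
    rw [hy, map_zero, norm_zero]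
    exact mul_nonneg (mul_nonneg hA hM0) (kernelMajorant_nonneg _ _)

/-- **The singular integrand is integrable** for a continuous compactly supported density
(`|K(x−y) f(y)| ≲ |x − y|⁻²` on a ball, integrable in `ℝ³`). [folklore] -/
theorem integrable_kernel_sub_apply {K : ℝ³ → V →L[ℝ] W} {A : ℝ} (hK : IsC1SingularKernel K A)
    {f : ℝ³ → V} (hf : Continuous f) (hfc : HasCompactSupport f) (x : ℝ³) :
    Integrable (fun y => K (x - y) (f y)) := by
  obtain ⟨M, hM⟩ := hf.bounded_above_of_compact_support hfc
  obtain ⟨R, hR⟩ := hfc.isCompact.isBounded.subset_closedBall 0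
  have hsupp : support f ⊆ closedBall 0 R := subset_tsupport f |>.trans hR
  refine Integrable.mono' (((integrable_kernelMajorant (‖x - 0‖ + R + 1)).comp_sub_left x).const_mul
    (A * M)) (aestronglyMeasurable_kernel_sub_apply hK hf x) (Eventually.of_forall fun y => ?_)
  exact norm_kernel_sub_apply_le hK hM hsupp x y

/-- **The regularised potentials converge uniformly to the potential**:
`‖v_ε(x) − v(x)‖ ≤ 12π A M ε` for `|f| ≤ M` continuous with compact support — the difference is
`∫ θ_ε(x−y) K(x−y) f(y) dy`, supported in `|x − y| ≤ 2ε` and dominated by `A M |x − y|⁻²`, whose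
integral over `|x − y| < 3ε` is `12π ε` (Gilbarg–Trudinger §4.1, proof of Lemma 4.1:
"`w_ε → w` uniformly"). [folklore] -/
theorem norm_truncPotential_sub_singularPotential_le {K : ℝ³ → V →L[ℝ] W} {A : ℝ}
    (hK : IsC1SingularKernel K A) {ε : ℝ} (hε : 0 < ε) {f : ℝ³ → V} (hf : Continuous f)
    (hfc : HasCompactSupport f) {M : ℝ} (hM : ∀ y, ‖f y‖ ≤ M) (x : ℝ³) :
    ‖truncPotential K ε f x - singularPotential K f x‖ ≤ 12 * π * A * M * ε := by
  have hA := hK.nonneg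
  have hM0 : 0 ≤ M := (norm_nonneg _).trans (hM x)
  have hint₁ : Integrable fun y => truncKernel K ε (x - y) (f y) :=
    (continuous_truncKernel_sub_apply hK hε hf x).integrable_of_hasCompactSupport
      (hasCompactSupport_truncKernel_sub_apply K ε hfc x)
  have hint₂ : Integrable fun y => K (x - y) (f y) := integrable_kernel_sub_apply hK hf hfc x
  rw [truncPotential, singularPotential, ← integral_sub hint₁ hint₂]
  -- pointwise domination of the difference by `A M · kernelMajorant (3ε) (x - y)`
  have hpt : ∀ y, ‖truncKernel K ε (x - y) (f y) - K (x - y) (f y)‖ ≤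
      A * M * kernelMajorant (3 * ε) (x - y) := by
    intro y
    by_cases hfar : 2 * ε ≤ ‖x - y‖
    · rw [truncKernel_eq K hε hfar, sub_self, norm_zero]
      exact mul_nonneg (mul_nonneg hA hM0) (kernelMajorant_nonneg _ _)
    · have hnear : ‖x - y‖ < 3 * ε := by linarith [not_le.1 hfar]
      have hmaj : kernelMajorant (3 * ε) (x - y) = (‖x - y‖ ^ 2)⁻¹ := by
        simp [kernelMajorant, indicator, hnear]
      rw [hmaj, ← sub_apply, truncKernel, sub_smul, one_smul, sub_sub_cancel_left,
        neg_apply, norm_neg, smul_apply, norm_smul, Real.norm_eq_abs]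
      calc |radialCutoff ε (2 * ε) (x - y)| * ‖K (x - y) (f y)‖ ≤ 1 * (‖K (x - y)‖ * ‖f y‖) := by
            gcongr
            · exact abs_radialCutoff_le_one _ _ _
            · exact ContinuousLinearMap.le_opNorm _ _
        _ ≤ 1 * (A * (‖x - y‖ ^ 2)⁻¹ * M) := by
            gcongr
            · exact hK.norm_le _
            · exact hM y
        _ = A * M * (‖x - y‖ ^ 2)⁻¹ := by ring
  have h1 : ‖∫ y, (truncKernel K ε (x - y) (f y) - K (x - y) (f y))‖ₑ ≤
      ENNReal.ofReal (12 * π * A * M * ε) := by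
    refine (enorm_integral_le_lintegral_enorm _).trans ?_
    have h2 : ∫⁻ y, ‖truncKernel K ε (x - y) (f y) - K (x - y) (f y)‖ₑ ≤
        ∫⁻ y, ENNReal.ofReal (A * M) * ENNReal.ofReal (kernelMajorant (3 * ε) (x - y)) := by
      refine lintegral_mono fun y => ?_
      rw [← ofReal_norm, ← ENNReal.ofReal_mul (mul_nonneg hA hM0)]
      exact ENNReal.ofReal_le_ofReal (hpt y)
    refine h2.trans ?_
    have hmk : Measurable fun y : ℝ³ => ENNReal.ofReal (kernelMajorant (3 * ε) (x - y)) :=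
      ((measurable_kernelMajorant (3 * ε)).comp (measurable_const.sub measurable_id)).ennreal_ofReal
    rw [lintegral_const_mul _ hmk,
      lintegral_sub_left_eq_self (μ := (volume : Measure ℝ³))
        (fun z => ENNReal.ofReal (kernelMajorant (3 * ε) z)) x,
      lintegral_kernelMajorant (by positivity), ← ENNReal.ofReal_mul (mul_nonneg hA hM0)]
    refine ENNReal.ofReal_le_ofReal (le_of_eq ?_)
    ring
  rw [← ofReal_norm] at h1
  exact (ENNReal.ofReal_le_ofReal_iff (by positivity)).1 h1

end Singular

/-! ### The radial integral `∫_{|z|<ρ} |z|^{γ−3} dz = 4π ρ^γ/γ` -/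

/-- The Hölder majorant `1_{|z| < ρ} |z|^{γ−3}` (the bound for `∇K(x − y)(f(y) − f(x))`,
`f ∈ C^γ`). [folklore] -/
def holderMajorant (γ ρ : ℝ) (z : ℝ³) : ℝ :=
  (ball (0 : ℝ³) ρ).indicator (fun z => ‖z‖ ^ (γ - 3)) z

/-- The Hölder majorant is nonnegative. [folklore] -/
theorem holderMajorant_nonneg (γ ρ : ℝ) (z : ℝ³) : 0 ≤ holderMajorant γ ρ z := by
  unfold holderMajorant
  exact indicator_nonneg (fun _ _ => Real.rpow_nonneg (norm_nonneg _) _) z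

/-- The Hölder majorant is measurable. [folklore] -/
theorem measurable_holderMajorant (γ ρ : ℝ) : Measurable (holderMajorant γ ρ) := by
  unfold holderMajorant
  exact Measurable.indicator (measurable_norm.pow_const _) measurableSet_ball

/-- **`|z|^{γ−3}` is integrable on balls of `ℝ³` for `γ > 0`** (`3 − γ < 3 = dim`). [folklore] -/
theorem integrable_holderMajorant {γ : ℝ} (hγ : 0 < γ) (ρ : ℝ) : Integrable (holderMajorant γ ρ) := by
  unfold holderMajorant
  rw [integrable_indicator_iff measurableSet_ball]
  refine integrableOn_ball_of_norm_le_rpow (E := ℝ³) (μ := volume)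
    (by rw [finrank_euclideanSpace_fin]; norm_num) (C := 1) (α := 3 - γ)
    (by rw [finrank_euclideanSpace_fin]; push_cast; linarith) (Eventually.of_forall fun z => ?_)
    ((measurable_norm.pow_const _).aestronglyMeasurable)
  rw [Real.norm_eq_abs, abs_of_nonneg (Real.rpow_nonneg (norm_nonneg _) _), one_mul, neg_sub]

/-- **Polar coordinates: `∫_{|z| < ρ} |z|^{γ−3} dz = 4π ρ^γ / γ` in `ℝ³`** (`γ > 0`, `ρ ≥ 0`):
`3 |B₁| ∫₀^ρ s² s^{γ−3} ds = 4π ∫₀^ρ s^{γ−1} ds`. This is the case `s = 3 − γ` of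
`NewtonPotentialHolder.integral_ball_norm_rpow_neg` (with `|B₁| = 4π/3` made explicit); a direct
proof is kept, following the landed `integral_kernelMajorant` of `BiotSavartBounds.lean`. [folklore] -/
theorem integral_holderMajorant {γ ρ : ℝ} (hγ : 0 < γ) (hρ : 0 ≤ ρ) :
    ∫ z, holderMajorant γ ρ z = 4 * π * ρ ^ γ / γ := by
  have hind : holderMajorant γ ρ = fun z : ℝ³ => (Iio ρ).indicator (fun s : ℝ => s ^ (γ - 3)) ‖z‖ := by
    funext z
    by_cases hz : ‖z‖ < ρ
    · simp [holderMajorant, indicator, hz]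
    · simp [holderMajorant, indicator, hz]
  rw [hind, integral_fun_norm_addHaar (volume : Measure ℝ³)
    (fun s : ℝ => (Iio ρ).indicator (fun s : ℝ => s ^ (γ - 3)) s), finrank_euclideanSpace_fin]
  have hinner : ∫ s in Ioi (0 : ℝ), s ^ (3 - 1) • (Iio ρ).indicator (fun s : ℝ => s ^ (γ - 3)) s =
      ρ ^ γ / γ := by
    have h1 : EqOn (fun s : ℝ => s ^ (3 - 1) • (Iio ρ).indicator (fun s : ℝ => s ^ (γ - 3)) s)
        ((Iio ρ).indicator fun s : ℝ => s ^ (γ - 1)) (Ioi 0) := by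
      intro s hs
      have hs0 : (0 : ℝ) < s := hs
      by_cases hsr : s < ρ
      · simp only [indicator, mem_Iio, hsr, if_true, smul_eq_mul]
        rw [show ((3 : ℕ) - 1 : ℕ) = 2 by norm_num, ← Real.rpow_natCast s 2,
          ← Real.rpow_add hs0]
        norm_num
        ring_nf
      · simp [indicator, hsr]
    rw [setIntegral_congr_fun measurableSet_Ioi h1, setIntegral_indicator measurableSet_Iio,
      Ioi_inter_Iio, ← integral_Ioc_eq_integral_Ioo, ← intervalIntegral.integral_of_le hρ,
      integral_rpow (Or.inl (by linarith))]
    rw [Real.zero_rpow (by linarith), sub_zero]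
    ring_nf
  rw [hinner, measureReal_def, EuclideanSpace.volume_ball_fin_three]
  rw [ENNReal.toReal_mul, ← ENNReal.ofReal_pow zero_le_one, one_pow, ENNReal.toReal_ofReal zero_le_one,
    ENNReal.toReal_ofReal (by positivity : (0 : ℝ) ≤ π * 4 / 3)]
  simp only [nsmul_eq_mul, smul_eq_mul]
  have hγ0 : γ ≠ 0 := hγ.ne'
  field_simp
  ring

/-- The lower Lebesgue integral of the Hölder majorant. [folklore] -/
theorem lintegral_holderMajorant {γ ρ : ℝ} (hγ : 0 < γ) (hρ : 0 ≤ ρ) :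
    ∫⁻ z, ENNReal.ofReal (holderMajorant γ ρ z) = ENNReal.ofReal (4 * π * ρ ^ γ / γ) := by
  rw [← integral_holderMajorant hγ hρ, ofReal_integral_eq_lintegral_ofReal
    (integrable_holderMajorant hγ ρ) (Eventually.of_forall (holderMajorant_nonneg γ ρ))]

end Literature.Analysis.FluidPDE
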